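import Literature.NumberTheory.EllipticCurves.BSDSelmerKimPConverseSkeletonProofs
import Literature.NumberTheory.EllipticCurves.BSDSelmerCMPConverseProofs
import Literature.NumberTheory.EllipticCurves.IwasawaSelmerTorsionProofs
import HarnessLib

/-!
# Burungale–Tian 2026, Thm. 3.1: the descent from Kato's main conjecture — `Λ`-module skeleton

Sibling *proofs* file (theorems only: no definition, no named fact, no instance —
D-0014/D-0026) of `Literature.NumberTheory.EllipticCurves.BSDSelmerCMPConverse`, for its named fact
`Literature.NumberTheory.EllipticCurves.burungaleTian_analyticRank_eq_zero_of_selmerCorank_eq_zero_of_hasCM`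
(A. A. Burungale, Y. Tian, *A rank zero `p`-converse to a theorem of Gross–Zagier, Kolyvagin and
Rubin*, Ann. of Math. (2) 203 (2026), no. 1, 1–13 = arXiv:2506.03465v2, **Thm. 1.1**: for a CM
elliptic curve `E/ℚ` and ANY prime `p`, `corank_{ℤ_p} Sel_{p^∞}(E/ℚ) = 0 ⟹ ord_{s=1} L(E, s) = 0`).

The first sibling (`BSDSelmerCMPConverseProofs`) proves the printed descent `K → ℚ` of Thm. 1.1
(p. 6) and reduces the fact to the `L`-value form of the source's **Theorem 3.1** for `f = f_E`
(`burungaleTian_analyticRank_eq_zero_of_selmerCorank_eq_zero_of_hasCM_of_L_one_ne_zero`: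
"`Sel_{p^∞}(E/ℚ)` finite `⟹ L(E, 1) ≠ 0`" for every CM `E/ℚ` and every `p` gives the fact); the
rank-zero siblings `BSDSelmerPConverseRankZeroProofs`, `BSDSelmerPConverseRankZeroOrdinaryProofs`,
`BSDSelmerCMPConverseOrdinaryProofs` prove that `L`-value form at the GOOD ORDINARY primes `p ≥ 5`
below Mazur's main conjecture and modularity — the slice that predates the source (Rubin's (1.2)).
What the source adds — every prime, in particular `p ∣ #𝒪_K^×` and the supersingular primes, "For
primes `p` of non-ordinary reduction, the existence of a desirable `p`-adic `L`-function is still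
elusive. We consider main conjectures in terms of the […] zeta elements" (§1.0.3) — rests on the
printed proof of Theorem 3.1 (p. 6 of the source), a descent from **Kato's main conjecture for CM
newforms in `Λ ⊗ ℚ`** (Thm. 2.6):

> "Let `T ⊂ V_{F_λ}(f)` be a `G_ℚ`-stable `𝒪_λ`-lattice. Since `H¹_f(ℚ, V_{F_λ}(f)(k/2)) = 0`, by
> the exact sequence [12, (14.9.3)], note that (3.1) `H²(ℤ[1/p], T(k/2)) ⊗ ℚ = 0`. Let
> `± = (-1)^{k/2-1}` and pick `γ ∈ V_{F_λ}(f)` such that `γ^± ≠ 0`. Let `z` be the image of the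
> Beilinson–Kato element `z_γ(f)` (cf. Theorem 2.4) under the map (3.2)
> `H¹(V_{F_λ}(f)) ≃ H¹(V_{F_λ}(f)(k/2)) → H¹(ℤ[1/p], T(k/2)) ⊗ ℚ`. […] Let `𝔮` be the kernel of
> the `𝒪_λ`-homomorphism `Λ → 𝒪_λ` mapping `σ_c` to `c^{-k/2}` […]. Note that the map (3.2) factors
> through `H¹(V_{F_λ}(f))_𝔮/𝔮H¹(V_{F_λ}(f))_𝔮`, and `H²(V_{F_λ}(f))_𝔮` vanishes by (3.1). Hence
> Theorem 2.6 implies that `z` is an `F_λ`-basis of `H¹(ℤ[1/p], T(k/2)) ⊗ ℚ`. (See also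
> [12, p. 242].) Since `H¹_f(ℚ, V_{F_λ}(f)(k/2))` vanishes, it follows that (3.3)
> `loc_p(z) ∉ H¹_f(ℚ_p, V_{F_λ}(f)(k/2))` […]. Finally, (3.3) and Kato's explicit reciprocity law
> [12, Thm. 12.5 (1)] imply that `ord_{s=k/2} L(s, f) = 0`."

with the inputs **Thm. 2.3** (Kato, Astérisque 295, Thm. 12.4: "(1) `H²(V_{F_λ}(f))` is a torsion
`(Λ ⊗ ℚ)`-module and (2) `H¹(V_{F_λ}(f))` is a free `(Λ ⊗ ℚ)`-module of rank one"), **Thm. 2.4**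
(Kato, Thm. 12.5: "(1) There exists a non-zero `F_λ`-linear map `V_{F_λ}(f) → H¹(V_{F_λ}(f));
γ ↦ z_γ(f)`. (2) Let `Z(f)` be the `(Λ ⊗ ℚ)`-submodule of `H¹(V_{F_λ}(f))` generated by `z_γ(f)`
for all `γ`. Then `H¹(V_{F_λ}(f))/Z(f)` is a torsion `(Λ ⊗ ℚ)`-module") and **Thm. 2.6** (Kato's
main conjecture for a CM newform `f` and any prime `p`: "`ξ(H²(V_{F_λ}(f))) = ξ(H¹(V_{F_λ}(f))/Z(f))`,
an equality of ideals in `Λ ⊗ ℚ`", from the equivariant main conjecture of Johnson-Leung–Kings,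
Thm. 2.1, through Kato §15), and **Remark 3.2**: "This deduction of the rank zero `p`-converse from
Kato's main conjecture holds for any elliptic newform."

## What is proved

None of the arithmetic objects exists in Mathlib or `Literature/` (no Iwasawa cohomology
`H^q(T) = lim H^q(ℤ[ζ_{p^n}, 1/p], T)`, no Beilinson–Kato elements, no explicit reciprocity law, no
equivariant main conjecture), and — D-0026 — none is ASSUMED here as a named fact. As in the tree's
other skeleton files (`KatoDivisibilitySkeletonProofs` for Kato's Thm. 17.4,
`BSDSelmerPConverseHeegnerMainConjectureProofs` for Wan's Thm. 3.17,
`BSDSelmerKimPConverseSkeletonProofs` for Kim's Thm. 1.1) they are abstract modules over the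
Iwasawa algebra `Λ = IwasawaAlgebra p = ℤ_[p]⟦T⟧`, the printed inputs about them are explicit
hypotheses, and what the quoted paragraph PROVES about them is proved. Dictionary: the source's
`Λ ⊗ ℚ = 𝒪_λ⟦G_∞⟧ ⊗ ℚ` is semi-local, `⊕_χ 𝒪_λ⟦T⟧[1/p]` over the characters `χ` of `Δ`
(`1 + T ↔ σ_u`, `u` a topological generator of `1 + 2pℤ_p`); the prime `𝔮` (kernel of
`σ_c ↦ c^{-k/2}`) singles out one component `χ₀`, on which it is `(1 + T - u^{-k/2})`, carried to
`(T)` by the translation `T ↦ T + u^{-k/2} - 1` (an automorphism of `𝒪_λ⟦T⟧`, as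
`u^{-k/2} ≡ 1 (mod 2p)`). So below `𝔮 = (T)` is the tree's `primeT p`, and the `𝔮`-coinvariants are
`N_Γ = N/TN = IwasawaAlgebra.coinvariants p N`; for `f = f_E`, `E/ℚ`, one has `F = ℚ`, `𝒪_λ = ℤ_p`,
`k = 2`, `V_{F_λ}(f)(k/2) = V_pE`. `S` stands for (a lattice in) the `χ₀`-component of
`H¹(V_{F_λ}(f))` — finitely generated and torsion-free, of rank one by Thm. 2.3 (2); `G ⊆ S` for the
set of (images of the) Beilinson–Kato elements `z_γ(f)`, `Z = span G` for `Z(f)_{χ₀}`; `X` for the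
`χ₀`-component of `H²(T)`, finitely generated torsion by Thm. 2.3 (1). "An equality of ideals in
`Λ ⊗ ℚ`" between ideals `I`, `J` of `Λ` is written with denominators cleared, `p^a · I = p^b · J`
(the units of `Λ[1/p]` are `p^ℤ · Λ^×`), exactly as in `BSDSelmerKimPConverseSkeletonProofs`.

* `IwasawaAlgebra.not_finite_coinvariants_of_noZeroSMulDivisors` — a nonzero finitely generated
  torsion-free `Λ`-module `S` has INFINITE `Γ`-coinvariants `S/TS` (if `N = #(S/TS)` then
  `N S ⊆ TS`, so `S` is torsion by the tree's Cayley–Hamilton criterion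
  `IwasawaDual.isTorsion_of_forall_nsmul_eq_X_smul`, Greenberg's "exercise"; torsion and
  torsion-free force `S = 0`). This is the integral shadow of "`H¹(V)_𝔮/𝔮H¹(V)_𝔮 ≠ 0`" for the free
  rank-one module of Thm. 2.3 (2).
* `IwasawaAlgebra.exists_forall_pow_smul_notMem_TSubmodule_of_lengthAt_eq_zero` — **the generator
  lemma**: if `S` is finitely generated torsion-free, `G ⊆ S` contains a nonzero element and
  `(S/span G)_𝔮 = 0` at `𝔮 = (T)`, then SOME `g ∈ G` has `p^m g ∉ TS` for every `m`, i.e. its class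
  in `S_Γ` is not `ℤ_p`-torsion. (Otherwise every element of `span G`, hence — through
  `(S/span G)_𝔮 = 0` — every element of `S`, is pushed into `TS` by an element outside the prime
  `𝔮`, so `(S/TS)_𝔮 = 0`, `S/TS` is finite, contradiction.) This is the content of "pick `γ` such
  that `γ^± ≠ 0` […] Hence […] `z` is an `F_λ`-basis" at the level of detail of the source: Kato
  [12, p. 242] identifies WHICH `γ` works (the sign `±`); that `some z_γ(f)` works is all that (3.3)
  consumes, and is what is proved.
* `IwasawaAlgebra.lengthAt_primeT_eq_zero_of_span_pow_mul_charIdeal_eq` — **Thm. 2.6 + (3.1) ⟹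
  `(H¹/Z)_𝔮 = 0`**: for finitely generated torsion `X`, `N` with `p^a · char_Λ(X) = p^b · char_Λ(N)`
  ("`ξ(H²(V)) = ξ(H¹(V)/Z(f))` in `Λ ⊗ ℚ`") and `X/TX` finite ("`H²(V_{F_λ}(f))_𝔮` vanishes by
  (3.1)": `H²(T)_Γ = H²(T)/𝔮 ↪ H²(ℤ[1/p], T(k/2))` from the cohomology sequence of
  `0 → T ⊗ Λ → T ⊗ Λ → T ⊗ Λ/𝔮 → 0`, and (3.1) says the target is finite), one has `N_𝔮 = 0`
  (Greenberg's Lemma 4.2 `T ∤ f_X`, transported along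
  the equality up to powers of `p`; tree lemmas `exists_span_pow_mul_le_of_span_pow_mul_eq`,
  `lengthAt_primeT_eq_zero_of_span_pow_mul_charIdeal_le` of the Kim skeleton).
* `IwasawaAlgebra.exists_forall_pow_smul_notMem_TSubmodule_of_span_pow_mul_charIdeal_eq` (and its
  `S_Γ`- and specialisation forms `…_mkQ_ne_zero_…`, `…_specialization_ne_zero_…`) — **the
  `Λ`-module step of the proof of Thm. 3.1** assembled: from Thm. 2.3, Thm. 2.4, Thm. 2.6 and (3.1),
  some Beilinson–Kato element `z_γ(f)` has non-torsion image in `S_Γ`, and under any additive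
  `sp : S_Γ → H` with `ℤ_p`-torsion kernel — the map (3.2) composed with Kato's specialisation
  `H¹(T)_Γ ↪ H¹(ℤ[1/p], T(k/2))`, injective with cokernel `H²(T)[𝔮]` — its image `z = sp(z_γ mod T)`
  is not torsion: "`z ≠ 0` in `H¹(ℤ[1/p], T(k/2)) ⊗ ℚ`". (The source says more — "`z` is an
  `F_λ`-basis", using Tate's Euler–Poincaré formula (14.9.5) for `dim = 1` — but (3.3) only uses
  `z ∉ H¹_f(ℚ, V(k/2)) = 0`, i.e. `z ≠ 0`.)
* `BurungaleTian2026.entireLFunction_one_ne_zero_of_skeleton` — **Thm. 3.1 for `f = f_E`, `E/ℚ` any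
  elliptic curve (Remark 3.2), `p` any prime, from the skeleton data**, keyed to the tree's objects
  `Sel_{p^∞}(E/ℚ) = W.selmerGroupPInfty p` and `L(E, 1) = W.entireLFunction 1`: (K) `S, G, X` as
  above with Thms. 2.3, 2.4, 2.6 as hypotheses `hZ`, `hX`, `hMC`; (3.1) as `hctl :
  Sel_{p^∞}(E/ℚ)` finite `⟹ X/TX` finite (the chain `Sel_{p^∞}(E/ℚ)` finite ⟹
  `H¹_f(ℚ, V_pE) = 0` ⟹ (14.9.3) `H²(ℤ[1/p], V) = 0` ⟹ `H²(ℤ[1/p], T(1))` finite ⟹ `H²(T)_Γ` finite);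
  (3.2) as `sp` with torsion kernel; "Since `H¹_f(ℚ, V)` vanishes, (3.3)" as `hloc : Sel_{p^∞}(E/ℚ)`
  finite ⟹ every `x ∈ H` with `res x = 0` is torsion, `res : H → P` standing for the localisation
  `loc_p` of (3.3) taken modulo `H¹_f(ℚ_p, V(1))`, whose kernel on `H ⊗ ℚ = H¹(ℤ[1/p], V(1))` is
  `H¹_f(ℚ, V(1))` (the local conditions away from `p` are empty: `H¹(ℚ_ℓ, V_pE) = 0` for `ℓ ≠ p`);
  Kato's explicit reciprocity law Thm. 12.5 (1) in the form the last sentence uses, `hERL`: for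
  each `γ`, `loc_p(z_γ)` non-torsion modulo `H¹_f ⟹ L(E, 1) ≠ 0` (`L(E, s) = L(f_E, s)`; the dual
  exponential of `loc_p z_γ(f)` is the product of a period of `γ` and `L_{(p)}(f, 1)`, so it
  vanishes when `L(f, 1) = 0`). Conclusion `L(E, 1) ≠ 0`;
  `…analyticRank_eq_zero_of_selmerCorank_eq_zero_of_skeleton`:
  `corank_{ℤ_p} Sel_{p^∞}(E/ℚ) = 0 ⟹ ord_{s=1} L(E, s) = 0` (tree theorems
  `finite_selmerGroupPInfty_iff_selmerCorank_eq_zero`, `analyticRank_eq_zero_of_entireLFunction_one_ne_zero`).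
* `burungaleTian_analyticRank_eq_zero_of_selmerCorank_eq_zero_of_hasCM_of_skeleton` — **the named
  fact from skeleton data for every CM `E/ℚ` and every prime `p`** (one hypothesis `hdata`, spelled
  out), through the first sibling's `…_of_L_one_ne_zero`. Composed, this is the complete statement
  of what remains between the tree and
  `burungaleTian_analyticRank_eq_zero_of_selmerCorank_eq_zero_of_hasCM_holds`, uniformly in `p`
  (no ordinary / `p ≥ 5` / `p ∤ #𝒪_K^×` hypothesis, unlike the landed slices): Kato's Iwasawa
  cohomology of `V_pE` with Thms. 12.4–12.5 (objects `S ⊇ G`, `X`, the specialisation `sp`), the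
  Poitou–Tate sequence (14.9.3) with the base change of `H²` ((3.1), `hctl`), the vanishing of
  `H¹(ℚ_ℓ, V_pE)` for `ℓ ≠ p` (`hloc`), Kato's explicit reciprocity law Thm. 12.5 (1) (`hERL`), and
  Kato's main conjecture for the CM newform `f_E` in `Λ ⊗ ℚ` (Thm. 2.6 = Johnson-Leung–Kings'
  equivariant main conjecture + Kato §15; `hMC`) — none of which is asserted here.

What is deliberately NOT here: any definition of `H^q(T)`, `z_γ(f)`, `H¹_f` or `loc_p`, and any new
named fact (D-0026); the sign bookkeeping `± = (-1)^{k/2-1}` of the choice of `γ` (not needed for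
the conclusion, see the generator lemma); the Euler–Poincaré count (14.9.5); weights `k ≠ 2` and
Hecke fields `F ≠ ℚ` (the tree's `L`-function and Selmer group are those of `E/ℚ`:
`-- TODO(general form): Thm. 3.1 for a CM newform of even weight `k` and `λ ∣ p` of `F`).

## References

* [BurungaleTian2026] A. A. Burungale, Y. Tian, Ann. of Math. (2) 203 (2026), 1–13 =
  arXiv:2506.03465v2: Thm. 1.1, §1.0.3, Thm. 2.1, Thms. 2.3, 2.4, 2.6, Thm. 3.1 and its proof
  ((3.1)–(3.3)), Remark 3.2, proof of Thm. 1.1 (pp. 1–6 of the held text `paper:arxiv-2506.03465`).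
* [Kato2004Asterisque] K. Kato, *`p`-adic Hodge theory and values of zeta functions of modular
  forms*, Astérisque 295 (2004), 117–290: Thm. 12.4, Thm. 12.5, Conj. 12.10, (14.9.3), (14.9.5),
  §15, p. 242 — cited through the source ([12] there).
* [JohnsonLeungKings2011] J. Johnson-Leung, G. Kings, J. reine angew. Math. 653 (2011), 75–114
  (Thm. 2.1 of the source).
* [Kim2022] C.-H. Kim, Math. Ann. 387 (2022): Prop. 2.7–2.8 (the same descent in rank one, whose
  tree skeleton `BSDSelmerKimPConverseSkeletonProofs` supplies the one-generator lemmas reused here).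
* [GreenbergLNM1716] R. Greenberg, LNM 1716 (1999), §1 p. 61 (the torsion "exercise"), §4 Lemma 4.2.
-/

noncomputable section

open scoped Classical

open WeierstrassCurve

universe u v w

namespace Literature.NumberTheory.EllipticCurves

/-! ### Module theory over `Λ = ℤ_p⟦T⟧` at the prime `𝔮 = (T)` -/

namespace IwasawaAlgebra

variable (p : ℕ) [Fact p.Prime]

/-- `p ∉ (T)`: the constant `p ∈ ℤ_p ⊂ Λ` lies in the complement of the prime `𝔮 = (T)` (its
constant term is `p ≠ 0`). [folklore] -/
theorem natCast_mem_primeCompl_primeT :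
    (p : IwasawaAlgebra p) ∈ (primeT p).asIdeal.primeCompl := by
  intro h
  have h' : (p : IwasawaAlgebra p) ∈ Ideal.span {(PowerSeries.X : IwasawaAlgebra p)} := h
  rw [mem_span_X_iff, map_natCast] at h'
  exact (NeZero.ne (p : ℤ_[p])) h'

/-- **A nonzero finitely generated torsion-free `Λ`-module has infinite `Γ`-coinvariants.** If
`S/TS` were finite, of order `N`, then `N S ⊆ TS`, so `S` would be a torsion `Λ`-module
(Cayley–Hamilton for `N · id` with image in `TS`: the tree's
`IwasawaDual.isTorsion_of_forall_nsmul_eq_X_smul`, Greenberg's "exercise", LNM 1716 §1 p. 61);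
a torsion-free torsion module is zero. (For the free rank-one `(Λ ⊗ ℚ)`-module `H¹(V_{F_λ}(f))`
of the source's Thm. 2.3 (2) this is "`H¹(V)_𝔮/𝔮H¹(V)_𝔮 ≅ F_λ ≠ 0`".)
[cite: GreenbergLNM1716, §1 p. 61] -/
theorem not_finite_coinvariants_of_noZeroSMulDivisors {S : Type u} [AddCommGroup S]
    [Module (IwasawaAlgebra p) S] [Module.Finite (IwasawaAlgebra p) S]
    [NoZeroSMulDivisors (IwasawaAlgebra p) S] {s₀ : S} (hs₀ : s₀ ≠ 0) :
    ¬ Finite (coinvariants p S) := by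
  intro hfin
  have hN0 : Nat.card (coinvariants p S) ≠ 0 := (Nat.card_pos (α := coinvariants p S)).ne'
  -- `N • x ∈ TS` for every `x`
  have h : ∀ x : S, ∃ y : S,
      Nat.card (coinvariants p S) • x = (PowerSeries.X : IwasawaAlgebra p) • y := by
    intro x
    have hx : (TSubmodule p S).mkQ (Nat.card (coinvariants p S) • x) = 0 := by
      rw [map_nsmul, Submodule.mkQ_apply, card_nsmul_eq_zero']
    rw [Submodule.mkQ_apply, Submodule.Quotient.mk_eq_zero, mem_TSubmodule_iff] at hx
    obtain ⟨y, hy⟩ := hx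
    exact ⟨y, hy.symm⟩
  -- hence `S` is torsion, and torsion-free: `s₀ = 0`
  have htors : Module.IsTorsion (IwasawaAlgebra p) S :=
    IwasawaDual.isTorsion_of_forall_nsmul_eq_X_smul hN0 h
  obtain ⟨⟨a, ha⟩, has⟩ := @htors s₀
  rw [Submonoid.mk_smul] at has
  exact hs₀ ((smul_eq_zero.mp has).resolve_left (nonZeroDivisors.ne_zero ha))

/-- **The generator lemma.** Let `S` be a finitely generated torsion-free `Λ`-module, `G ⊆ S` a
subset containing a nonzero element, and suppose `(S/span G)_𝔮 = 0` at `𝔮 = (T)`. Then some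
`g ∈ G` satisfies `p^m g ∉ TS` for every `m`: its class in `S_Γ = S/TS` is not `ℤ_p`-torsion.
Proof: otherwise every `g ∈ G` is pushed into `TS` by a power of `p`, hence (span induction; the
complement of the prime `𝔮` is multiplicatively closed and contains `p`) every element of `span G`
is pushed into `TS` by an element outside `𝔮`, hence — `(S/span G)_𝔮 = 0` pushes every `s ∈ S`
into `span G` by an element outside `𝔮` — so is every element of `S`; thus `(S/TS)_𝔮 = 0`, i.e.
`S/TS` is finite (`finite_iff_lengthAt_eq_zero_of_X_smul_eq_zero`), contradicting
`not_finite_coinvariants_of_noZeroSMulDivisors`. In the source (proof of Thm. 3.1, with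
[12, p. 242]) `G` is the set of Beilinson–Kato elements `z_γ(f)`, `γ ∈ V_{F_λ}(f)`, and the lemma
is "pick `γ` such that `γ^± ≠ 0` […] `z` is an `F_λ`-basis" without the identification of the
good `γ` by a sign. [cite: BurungaleTian2026, Thm. 3.1 (proof, p. 6)] -/
theorem exists_forall_pow_smul_notMem_TSubmodule_of_lengthAt_eq_zero {S : Type u}
    [AddCommGroup S] [Module (IwasawaAlgebra p) S] [Module.Finite (IwasawaAlgebra p) S]
    [NoZeroSMulDivisors (IwasawaAlgebra p) S] {G : Set S} (hG : ∃ g ∈ G, g ≠ 0)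
    (hZ : Module.lengthAt (IwasawaAlgebra p) (S ⧸ Submodule.span (IwasawaAlgebra p) G)
      (primeT p) = 0) :
    ∃ g ∈ G, ∀ m : ℕ, ((p : IwasawaAlgebra p) ^ m) • g ∉ TSubmodule p S := by
  obtain ⟨g₀, -, hg₀⟩ := hG
  by_contra hcon
  push Not at hcon
  -- every element of `span G` is pushed into `TS` by an element outside `𝔮`
  have hZ' : ∀ z ∈ Submodule.span (IwasawaAlgebra p) G,
      ∃ t ∈ (primeT p).asIdeal.primeCompl, t • z ∈ TSubmodule p S := by
    intro z hz
    induction hz using Submodule.span_induction with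
    | mem g hg =>
      obtain ⟨m, hm⟩ := hcon g hg
      exact ⟨(p : IwasawaAlgebra p) ^ m, Submonoid.pow_mem _ (natCast_mem_primeCompl_primeT p) m, hm⟩
    | zero => exact ⟨1, Submonoid.one_mem _, by rw [smul_zero]; exact Submodule.zero_mem _⟩
    | add x y _ _ hx hy =>
      obtain ⟨t₁, ht₁, hx⟩ := hx
      obtain ⟨t₂, ht₂, hy⟩ := hy
      refine ⟨t₁ * t₂, Submonoid.mul_mem _ ht₁ ht₂, ?_⟩
      rw [smul_add]
      refine Submodule.add_mem _ ?_ ?_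
      · rw [mul_comm, mul_smul]
        exact Submodule.smul_mem _ _ hx
      · rw [mul_smul]
        exact Submodule.smul_mem _ _ hy
    | smul r x _ hx =>
      obtain ⟨t, ht, hx⟩ := hx
      exact ⟨t, ht, by rw [smul_comm]; exact Submodule.smul_mem _ _ hx⟩
  -- `(S/span G)_𝔮 = 0`: every `s ∈ S` is pushed into `span G`, hence into `TS`, from outside `𝔮`
  have hsub := (Module.lengthAt_eq_zero_iff (primeT p)).mp hZ
  have hS' : ∀ s : S, ∃ t ∈ (primeT p).asIdeal.primeCompl, t • s ∈ TSubmodule p S := by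
    intro s
    obtain ⟨r, hr, hrs⟩ := LocalizedModule.subsingleton_iff.mp hsub
      (Submodule.Quotient.mk s : S ⧸ Submodule.span (IwasawaAlgebra p) G)
    rw [← Submodule.Quotient.mk_smul, Submodule.Quotient.mk_eq_zero] at hrs
    obtain ⟨t, ht, hts⟩ := hZ' _ hrs
    exact ⟨t * r, Submonoid.mul_mem _ ht hr, by rw [mul_smul]; exact hts⟩
  -- hence `(S/TS)_𝔮 = 0`, i.e. `S/TS` is finite: contradiction
  have hlen : Module.lengthAt (IwasawaAlgebra p) (coinvariants p S) (primeT p) = 0 := by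
    rw [Module.lengthAt_eq_zero_iff]
    refine LocalizedModule.subsingleton_iff.mpr fun q ↦ ?_
    induction q using Submodule.Quotient.induction_on with
    | H s =>
      obtain ⟨t, ht, hts⟩ := hS' s
      refine ⟨t, ht, ?_⟩
      rw [← Submodule.Quotient.mk_smul, Submodule.Quotient.mk_eq_zero]
      exact hts
  exact not_finite_coinvariants_of_noZeroSMulDivisors p hg₀
    ((finite_iff_lengthAt_eq_zero_of_X_smul_eq_zero p (coinvariants p S)
      (fun q ↦ X_smul_coinvariants p S q)).mpr hlen)

/-- **Thm. 2.6 and (3.1) ⟹ `(H¹(V)/Z(f))_𝔮 = 0`.** Let `X` and `N` be finitely generated torsion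
`Λ`-modules — the `χ₀`-components of `H²(T)` and of `H¹/Z` — with
`p^a · char_Λ(X) = p^b · char_Λ(N)` for some `a, b` (Kato's main conjecture for the CM newform `f`,
"`ξ(H²(V_{F_λ}(f))) = ξ(H¹(V_{F_λ}(f))/Z(f))`, an equality of ideals in `Λ ⊗ ℚ`", denominators
cleared), and `X/TX` finite ("`H²(V_{F_λ}(f))_𝔮` vanishes by (3.1)", through
`H²(T)_Γ = H²(ℤ[1/p], T(k/2))`). Then `N_𝔮 = 0` at `𝔮 = (T)`: Greenberg's Lemma 4.2 gives
`T ∤ f_X`, and `p^a f_X ∈ p^b char(N) ⊆ char(N)` has `T`-order `0`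
(`lengthAt_primeT_eq_zero_of_span_pow_mul_charIdeal_le`). Only the divisibility
`p^a char(X) ⊆ char(N)` of the equality is used. [cite: BurungaleTian2026, Thm. 2.6 and Thm. 3.1 (proof, (3.1))] -/
theorem lengthAt_primeT_eq_zero_of_span_pow_mul_charIdeal_eq {X : Type v} {N : Type u}
    [AddCommGroup X] [Module (IwasawaAlgebra p) X] [Module.Finite (IwasawaAlgebra p) X]
    [AddCommGroup N] [Module (IwasawaAlgebra p) N] [Module.Finite (IwasawaAlgebra p) N]
    (hX : Module.IsTorsion (IwasawaAlgebra p) X) (hN : Module.IsTorsion (IwasawaAlgebra p) N)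
    (hMC : ∃ a b : ℕ,
      Ideal.span {(p : IwasawaAlgebra p) ^ a} * Module.charIdeal (IwasawaAlgebra p) X =
        Ideal.span {(p : IwasawaAlgebra p) ^ b} * Module.charIdeal (IwasawaAlgebra p) N)
    (hfin : Finite (coinvariants p X)) :
    Module.lengthAt (IwasawaAlgebra p) N (primeT p) = 0 := by
  obtain ⟨a, b, h⟩ := hMC
  exact lengthAt_primeT_eq_zero_of_span_pow_mul_charIdeal_le p hX hN hfin
    (exists_span_pow_mul_le_of_span_pow_mul_eq p ⟨b, a, h.symm⟩)

/-- **The `Λ`-module step of the proof of Thm. 3.1 ("Hence Theorem 2.6 implies that `z` is an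
`F_λ`-basis of `H¹(ℤ[1/p], T(k/2)) ⊗ ℚ`. (See also [12, p. 242].)").** Over `Λ = ℤ_[p]⟦T⟧`
(the `χ₀`-component of the source's `Λ`, `𝔮 = (T)`), let
* `S` be finitely generated and torsion-free and `G ⊆ S` a subset with a nonzero element such that
  `S/span G` is torsion — `S = H¹` with Thm. 2.3 (2), `G = {z_γ(f)}` with Thm. 2.4 (1)–(2);
* `X` be finitely generated torsion — `X = H²`, Thm. 2.3 (1);
* `p^a · char_Λ(X) = p^b · char_Λ(S/span G)` — Thm. 2.6;
* `X/TX` be finite — (3.1).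
Then some Beilinson–Kato element `g ∈ G` has `p^m g ∉ TS` for all `m`: its image in
`S_Γ = H¹_𝔮/𝔮H¹_𝔮 ∩ (lattice)` is not torsion.
[cite: BurungaleTian2026, Thm. 3.1 (proof, p. 6), Thms. 2.3, 2.4, 2.6] -/
theorem exists_forall_pow_smul_notMem_TSubmodule_of_span_pow_mul_charIdeal_eq
    {S : Type u} {X : Type v}
    [AddCommGroup S] [Module (IwasawaAlgebra p) S] [Module.Finite (IwasawaAlgebra p) S]
    [NoZeroSMulDivisors (IwasawaAlgebra p) S]
    [AddCommGroup X] [Module (IwasawaAlgebra p) X] [Module.Finite (IwasawaAlgebra p) X]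
    {G : Set S} (hG : ∃ g ∈ G, g ≠ 0)
    (hZ : Module.IsTorsion (IwasawaAlgebra p) (S ⧸ Submodule.span (IwasawaAlgebra p) G))
    (hX : Module.IsTorsion (IwasawaAlgebra p) X)
    (hMC : ∃ a b : ℕ,
      Ideal.span {(p : IwasawaAlgebra p) ^ a} * Module.charIdeal (IwasawaAlgebra p) X =
        Ideal.span {(p : IwasawaAlgebra p) ^ b} *
          Module.charIdeal (IwasawaAlgebra p) (S ⧸ Submodule.span (IwasawaAlgebra p) G))
    (hfin : Finite (coinvariants p X)) :
    ∃ g ∈ G, ∀ m : ℕ, ((p : IwasawaAlgebra p) ^ m) • g ∉ TSubmodule p S :=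
  exists_forall_pow_smul_notMem_TSubmodule_of_lengthAt_eq_zero p hG
    (lengthAt_primeT_eq_zero_of_span_pow_mul_charIdeal_eq p hX hZ hMC hfin)

/-- The same conclusion in the `Γ`-coinvariants `S_Γ = S/TS`: some `g ∈ G` has
`p^m • (g mod TS) ≠ 0` for every `m`. [cite: BurungaleTian2026, Thm. 3.1 (proof, p. 6)] -/
theorem exists_forall_pow_smul_mkQ_ne_zero_of_span_pow_mul_charIdeal_eq
    {S : Type u} {X : Type v}
    [AddCommGroup S] [Module (IwasawaAlgebra p) S] [Module.Finite (IwasawaAlgebra p) S]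
    [NoZeroSMulDivisors (IwasawaAlgebra p) S]
    [AddCommGroup X] [Module (IwasawaAlgebra p) X] [Module.Finite (IwasawaAlgebra p) X]
    {G : Set S} (hG : ∃ g ∈ G, g ≠ 0)
    (hZ : Module.IsTorsion (IwasawaAlgebra p) (S ⧸ Submodule.span (IwasawaAlgebra p) G))
    (hX : Module.IsTorsion (IwasawaAlgebra p) X)
    (hMC : ∃ a b : ℕ,
      Ideal.span {(p : IwasawaAlgebra p) ^ a} * Module.charIdeal (IwasawaAlgebra p) X =
        Ideal.span {(p : IwasawaAlgebra p) ^ b} *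
          Module.charIdeal (IwasawaAlgebra p) (S ⧸ Submodule.span (IwasawaAlgebra p) G))
    (hfin : Finite (coinvariants p X)) :
    ∃ g ∈ G, ∀ m : ℕ, p ^ m • (Submodule.Quotient.mk g : coinvariants p S) ≠ 0 := by
  obtain ⟨g, hg, h⟩ :=
    exists_forall_pow_smul_notMem_TSubmodule_of_span_pow_mul_charIdeal_eq p hG hZ hX hMC hfin
  refine ⟨g, hg, fun m h0 ↦ h m ?_⟩
  rw [← Nat.cast_smul_eq_nsmul (IwasawaAlgebra p), ← Submodule.Quotient.mk_smul,
    Submodule.Quotient.mk_eq_zero, Nat.cast_pow] at h0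
  exact h0

/-- **Specialisation ("`z` […] in `H¹(ℤ[1/p], T(k/2)) ⊗ ℚ`" is nonzero).** If moreover
`sp : S/TS → H` is additive with `ℤ_p`-torsion kernel — the map (3.2) followed by Kato's
specialisation sequence `0 → H¹(T)_Γ → H¹(ℤ[1/p], T(k/2)) → H²(T)[𝔮] → 0`, restricted to the
`χ₀`-component — then for some `g ∈ G` the element `z := sp (g mod TS)` has `p^m • z ≠ 0` for all
`m`. [cite: BurungaleTian2026, Thm. 3.1 (proof, (3.2) and the sentence after it)] -/
theorem exists_forall_pow_smul_specialization_ne_zero_of_span_pow_mul_charIdeal_eq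
    {S : Type u} {X : Type v} {H : Type*}
    [AddCommGroup S] [Module (IwasawaAlgebra p) S] [Module.Finite (IwasawaAlgebra p) S]
    [NoZeroSMulDivisors (IwasawaAlgebra p) S]
    [AddCommGroup X] [Module (IwasawaAlgebra p) X] [Module.Finite (IwasawaAlgebra p) X]
    [AddCommGroup H]
    {G : Set S} (hG : ∃ g ∈ G, g ≠ 0)
    (hZ : Module.IsTorsion (IwasawaAlgebra p) (S ⧸ Submodule.span (IwasawaAlgebra p) G))
    (hX : Module.IsTorsion (IwasawaAlgebra p) X)
    (hMC : ∃ a b : ℕ,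
      Ideal.span {(p : IwasawaAlgebra p) ^ a} * Module.charIdeal (IwasawaAlgebra p) X =
        Ideal.span {(p : IwasawaAlgebra p) ^ b} *
          Module.charIdeal (IwasawaAlgebra p) (S ⧸ Submodule.span (IwasawaAlgebra p) G))
    (hfin : Finite (coinvariants p X))
    (sp : coinvariants p S →+ H) (hsp : ∀ x, sp x = 0 → ∃ n : ℕ, p ^ n • x = 0) :
    ∃ g ∈ G, ∀ m : ℕ, p ^ m • sp (Submodule.Quotient.mk g) ≠ 0 := by
  obtain ⟨g, hg, h⟩ :=
    exists_forall_pow_smul_mkQ_ne_zero_of_span_pow_mul_charIdeal_eq p hG hZ hX hMC hfin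
  refine ⟨g, hg, fun m h0 ↦ ?_⟩
  rw [← map_nsmul] at h0
  obtain ⟨n, hn⟩ := hsp _ h0
  rw [← mul_nsmul', ← pow_add] at hn
  exact h (n + m) hn

end IwasawaAlgebra

/-! ### Thm. 3.1 for `f = f_E` and Thm. 1.1, along the printed proof -/

namespace BurungaleTian2026

variable (W : WeierstrassCurve ℚ) [W.IsElliptic] (p : ℕ) [Fact p.Prime]

omit [W.IsElliptic] in
/-- **Burungale–Tian 2026, Thm. 3.1 for the newform `f = f_E` of an elliptic curve `E/ℚ` and any
prime `p`, from the `Λ`-module skeleton of its proof** (by Remark 3.2 no CM hypothesis is needed for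
the DEDUCTION; CM enters only through the input Thm. 2.6). For `E/ℚ` (model `W`) and `p` suppose
given, over `Λ = ℤ_[p]⟦T⟧` (the `χ₀`-component singled out by `𝔮`, `𝔮 = (T)`):
* (K) `S` finitely generated torsion-free, `G ⊆ S` with a nonzero element and `S/span G` torsion,
  `X` finitely generated torsion — Kato's `H¹ ⊇ {z_γ(f)}` and `H²` for `T = T_pE` (Thms. 2.3, 2.4
  = Astérisque 295, Thms. 12.4, 12.5);
* (MC) `p^a · char_Λ(X) = p^b · char_Λ(S/span G)` — Thm. 2.6, Kato's main conjecture for the CM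
  newform `f_E` in `Λ ⊗ ℚ` (Johnson-Leung–Kings + Kato §15);
* (3.1) `Sel_{p^∞}(E/ℚ)` finite `⟹ X/TX` finite — "(3.1) `H²(ℤ[1/p], T(1)) ⊗ ℚ = 0`" from
  `H¹_f(ℚ, V_pE) = 0` by [12, (14.9.3)], and `H²(T)_Γ ↪ H²(ℤ[1/p], T(1))`; here `Sel_{p^∞}(E/ℚ)`
  IS the tree's `W.selmerGroupPInfty p`, and its finiteness is `H¹_f(ℚ, V_pE) = 0`;
* (3.2) `sp : S/TS → H` additive with torsion kernel — the twist-and-specialise map (3.2) into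
  `H = H¹(ℤ[1/p], T(1))`;
* (LOC) `Sel_{p^∞}(E/ℚ)` finite `⟹` every `x ∈ H` with `res x = 0` is torsion — "Since
  `H¹_f(ℚ, V(1))` vanishes, it follows that (3.3) `loc_p(z) ∉ H¹_f(ℚ_p, V(1))`", `res : H → P`
  standing for `loc_p` followed by `H¹(ℚ_p, V(1)) → H¹(ℚ_p, V(1))/H¹_f`;
* (ERL) for each `g ∈ G`: if `res (sp (g mod TS))` is not torsion then `L(E, 1) ≠ 0` — "(3.3) and
  Kato's explicit reciprocity law [12, Thm. 12.5 (1)] imply that `ord_{s=k/2} L(s, f) = 0`", with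
  `L(E, s) = L(f_E, s)` and `L(E, 1) = W.entireLFunction 1`.
If `Sel_{p^∞}(E/ℚ)` is finite, then `L(E, 1) ≠ 0`. Proof: the `Λ`-module step
(`exists_forall_pow_smul_specialization_ne_zero_of_span_pow_mul_charIdeal_eq`) produces `g ∈ G`
with `z = sp (g mod TS)` non-torsion; by (LOC) `res z` is non-torsion
(`Kim2022.pow_smul_map_ne_zero_of_ker_torsion`); then (ERL).
[cite: BurungaleTian2026, Thm. 3.1 (proof, p. 6) and Remark 3.2] -/
theorem entireLFunction_one_ne_zero_of_skeleton
    {S : Type u} [AddCommGroup S] [Module (IwasawaAlgebra p) S]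
    [Module.Finite (IwasawaAlgebra p) S] [NoZeroSMulDivisors (IwasawaAlgebra p) S]
    {X : Type v} [AddCommGroup X] [Module (IwasawaAlgebra p) X]
    [Module.Finite (IwasawaAlgebra p) X]
    {H : Type w} [AddCommGroup H] {P : Type*} [AddCommGroup P]
    {G : Set S} (hG : ∃ g ∈ G, g ≠ 0)
    (hZ : Module.IsTorsion (IwasawaAlgebra p) (S ⧸ Submodule.span (IwasawaAlgebra p) G))
    (hX : Module.IsTorsion (IwasawaAlgebra p) X)
    (hMC : ∃ a b : ℕ,
      Ideal.span {(p : IwasawaAlgebra p) ^ a} * Module.charIdeal (IwasawaAlgebra p) X =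
        Ideal.span {(p : IwasawaAlgebra p) ^ b} *
          Module.charIdeal (IwasawaAlgebra p) (S ⧸ Submodule.span (IwasawaAlgebra p) G))
    (hctl : Finite (W.selmerGroupPInfty p) → Finite (IwasawaAlgebra.coinvariants p X))
    (sp : IwasawaAlgebra.coinvariants p S →+ H) (hsp : ∀ x, sp x = 0 → ∃ n : ℕ, p ^ n • x = 0)
    (res : H →+ P)
    (hloc : Finite (W.selmerGroupPInfty p) → ∀ x : H, res x = 0 → ∃ n : ℕ, p ^ n • x = 0)
    (hERL : ∀ g ∈ G, (∀ m : ℕ, p ^ m • res (sp (Submodule.Quotient.mk g)) ≠ 0) →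
      W.entireLFunction 1 ≠ 0)
    (hfin : Finite (W.selmerGroupPInfty p)) :
    W.entireLFunction 1 ≠ 0 := by
  -- "Hence Theorem 2.6 implies that `z` is [nonzero]": some `z_γ(f)` specialises to a non-torsion `z`
  obtain ⟨g, hg, hz⟩ :=
    IwasawaAlgebra.exists_forall_pow_smul_specialization_ne_zero_of_span_pow_mul_charIdeal_eq p
      hG hZ hX hMC (hctl hfin) sp hsp
  -- (3.3): `loc_p(z) ∉ H¹_f(ℚ_p, V(1))`; then the explicit reciprocity law
  exact hERL g hg (Kim2022.pow_smul_map_ne_zero_of_ker_torsion res hz (hloc hfin))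

/-- **The rank-zero `p`-converse for `E/ℚ` at ANY prime `p` from the skeleton** (Thm. 1.1 for a
curve over `ℚ`, and — Remark 3.2 — for any `E/ℚ` granted the inputs):
`corank_{ℤ_p} Sel_{p^∞}(E/ℚ) = 0 ⟹ ord_{s=1} L(E, s) = 0`, the corank being the tree's
`W.selmerCorank p` (`= 0` iff `Sel_{p^∞}(E/ℚ)` is finite,
`finite_selmerGroupPInfty_iff_selmerCorank_eq_zero`) and the order of vanishing the tree's
`W.analyticRank` (`= 0` as soon as `L(E, 1) ≠ 0`, `analyticRank_eq_zero_of_entireLFunction_one_ne_zero`).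
[cite: BurungaleTian2026, Thm. 1.1 and Thm. 3.1 (proof), Remark 3.2] -/
theorem analyticRank_eq_zero_of_selmerCorank_eq_zero_of_skeleton
    {S : Type u} [AddCommGroup S] [Module (IwasawaAlgebra p) S]
    [Module.Finite (IwasawaAlgebra p) S] [NoZeroSMulDivisors (IwasawaAlgebra p) S]
    {X : Type v} [AddCommGroup X] [Module (IwasawaAlgebra p) X]
    [Module.Finite (IwasawaAlgebra p) X]
    {H : Type w} [AddCommGroup H] {P : Type*} [AddCommGroup P]
    {G : Set S} (hG : ∃ g ∈ G, g ≠ 0)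
    (hZ : Module.IsTorsion (IwasawaAlgebra p) (S ⧸ Submodule.span (IwasawaAlgebra p) G))
    (hX : Module.IsTorsion (IwasawaAlgebra p) X)
    (hMC : ∃ a b : ℕ,
      Ideal.span {(p : IwasawaAlgebra p) ^ a} * Module.charIdeal (IwasawaAlgebra p) X =
        Ideal.span {(p : IwasawaAlgebra p) ^ b} *
          Module.charIdeal (IwasawaAlgebra p) (S ⧸ Submodule.span (IwasawaAlgebra p) G))
    (hctl : Finite (W.selmerGroupPInfty p) → Finite (IwasawaAlgebra.coinvariants p X))
    (sp : IwasawaAlgebra.coinvariants p S →+ H) (hsp : ∀ x, sp x = 0 → ∃ n : ℕ, p ^ n • x = 0)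
    (res : H →+ P)
    (hloc : Finite (W.selmerGroupPInfty p) → ∀ x : H, res x = 0 → ∃ n : ℕ, p ^ n • x = 0)
    (hERL : ∀ g ∈ G, (∀ m : ℕ, p ^ m • res (sp (Submodule.Quotient.mk g)) ≠ 0) →
      W.entireLFunction 1 ≠ 0)
    (h0 : W.selmerCorank p = 0) :
    W.analyticRank = 0 :=
  analyticRank_eq_zero_of_entireLFunction_one_ne_zero W
    (entireLFunction_one_ne_zero_of_skeleton W p hG hZ hX hMC hctl sp hsp res hloc hERL
      ((finite_selmerGroupPInfty_iff_selmerCorank_eq_zero W p).2 h0))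

/-- **Contrapositive form**: from the skeleton data, `L(E, 1) = 0 ⟹ corank_{ℤ_p} Sel_{p^∞}(E/ℚ) ≥ 1`
for EVERY prime `p` (the shape in which Thm. 1.1 feeds the even parity Goldfeld theorem, Thm. 1.2,
at `p = 2`). [cite: BurungaleTian2026, Thm. 1.1, §1.0.3] -/
theorem one_le_selmerCorank_of_entireLFunction_one_eq_zero_of_skeleton
    {S : Type u} [AddCommGroup S] [Module (IwasawaAlgebra p) S]
    [Module.Finite (IwasawaAlgebra p) S] [NoZeroSMulDivisors (IwasawaAlgebra p) S]
    {X : Type v} [AddCommGroup X] [Module (IwasawaAlgebra p) X]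
    [Module.Finite (IwasawaAlgebra p) X]
    {H : Type w} [AddCommGroup H] {P : Type*} [AddCommGroup P]
    {G : Set S} (hG : ∃ g ∈ G, g ≠ 0)
    (hZ : Module.IsTorsion (IwasawaAlgebra p) (S ⧸ Submodule.span (IwasawaAlgebra p) G))
    (hX : Module.IsTorsion (IwasawaAlgebra p) X)
    (hMC : ∃ a b : ℕ,
      Ideal.span {(p : IwasawaAlgebra p) ^ a} * Module.charIdeal (IwasawaAlgebra p) X =
        Ideal.span {(p : IwasawaAlgebra p) ^ b} *
          Module.charIdeal (IwasawaAlgebra p) (S ⧸ Submodule.span (IwasawaAlgebra p) G))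
    (hctl : Finite (W.selmerGroupPInfty p) → Finite (IwasawaAlgebra.coinvariants p X))
    (sp : IwasawaAlgebra.coinvariants p S →+ H) (hsp : ∀ x, sp x = 0 → ∃ n : ℕ, p ^ n • x = 0)
    (res : H →+ P)
    (hloc : Finite (W.selmerGroupPInfty p) → ∀ x : H, res x = 0 → ∃ n : ℕ, p ^ n • x = 0)
    (hERL : ∀ g ∈ G, (∀ m : ℕ, p ^ m • res (sp (Submodule.Quotient.mk g)) ≠ 0) →
      W.entireLFunction 1 ≠ 0)
    (hL : W.entireLFunction 1 = 0) :
    1 ≤ W.selmerCorank p := by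
  by_contra h
  have h0 : W.selmerCorank p = 0 := by omega
  exact entireLFunction_one_ne_zero_of_skeleton W p hG hZ hX hMC hctl sp hsp res hloc hERL
    ((finite_selmerGroupPInfty_iff_selmerCorank_eq_zero W p).2 h0) hL

end BurungaleTian2026

/-! ### The named fact from skeleton data for every CM `E/ℚ` and every prime -/

/-- **`burungaleTian_analyticRank_eq_zero_of_selmerCorank_eq_zero_of_hasCM` (Burungale–Tian 2026,
Thm. 1.1) from the `Λ`-module skeleton of the proof of Thm. 3.1.** Hypothesis `hdata`: for every CM
elliptic curve `E/ℚ` (model `W`) and every prime `p` — exactly the printed hypotheses of Thm. 1.1 /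
the abstract, under which Thm. 2.6 supplies (MC) (the newform `f_E` of a CM curve is a CM newform)
and Kato's theorems supply (K), (3.1), (3.2), (LOC), (ERL) — there exist skeleton data
`(S, G, X, H, P, sp, res)` as in `BurungaleTian2026.entireLFunction_one_ne_zero_of_skeleton`. Then
the named fact holds, through the first sibling's
`burungaleTian_analyticRank_eq_zero_of_selmerCorank_eq_zero_of_hasCM_of_L_one_ne_zero` (Thm. 3.1
for `f = f_E` ⟹ the fact). So
`burungaleTian_analyticRank_eq_zero_of_selmerCorank_eq_zero_of_hasCM_holds` is this theorem
applied to a construction of the data — Kato's Iwasawa cohomology of `T_pE` with Thms. 12.4–12.5,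
the Poitou–Tate sequence (14.9.3) and the base change of `H²`, the vanishing of `H¹(ℚ_ℓ, V_pE)`
(`ℓ ≠ p`), Kato's explicit reciprocity law Thm. 12.5 (1), and Kato's main conjecture for CM
newforms in `Λ ⊗ ℚ` (Thm. 2.6) — uniformly in `p`; nothing is asserted here.
[cite: BurungaleTian2026, Thm. 1.1, Thm. 3.1 (proof), Thms. 2.3, 2.4, 2.6] -/
theorem burungaleTian_analyticRank_eq_zero_of_selmerCorank_eq_zero_of_hasCM_of_skeleton
    (hdata : ∀ (W : WeierstrassCurve ℚ) [W.IsElliptic], W.HasCM → ∀ (p : ℕ) [Fact p.Prime],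
      ∃ (S : Type) (_ : AddCommGroup S) (_ : Module (IwasawaAlgebra p) S)
        (_ : Module.Finite (IwasawaAlgebra p) S) (_ : NoZeroSMulDivisors (IwasawaAlgebra p) S)
        (X : Type) (_ : AddCommGroup X) (_ : Module (IwasawaAlgebra p) X)
        (_ : Module.Finite (IwasawaAlgebra p) X)
        (H : Type) (_ : AddCommGroup H) (P : Type) (_ : AddCommGroup P)
        (G : Set S) (sp : IwasawaAlgebra.coinvariants p S →+ H) (res : H →+ P),
        (∃ g ∈ G, g ≠ 0) ∧
        Module.IsTorsion (IwasawaAlgebra p) (S ⧸ Submodule.span (IwasawaAlgebra p) G) ∧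
        Module.IsTorsion (IwasawaAlgebra p) X ∧
        (∃ a b : ℕ,
          Ideal.span {(p : IwasawaAlgebra p) ^ a} * Module.charIdeal (IwasawaAlgebra p) X =
            Ideal.span {(p : IwasawaAlgebra p) ^ b} *
              Module.charIdeal (IwasawaAlgebra p) (S ⧸ Submodule.span (IwasawaAlgebra p) G)) ∧
        (Finite (W.selmerGroupPInfty p) → Finite (IwasawaAlgebra.coinvariants p X)) ∧
        (∀ x, sp x = 0 → ∃ n : ℕ, p ^ n • x = 0) ∧
        (Finite (W.selmerGroupPInfty p) → ∀ x : H, res x = 0 → ∃ n : ℕ, p ^ n • x = 0) ∧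
        (∀ g ∈ G, (∀ m : ℕ, p ^ m • res (sp (Submodule.Quotient.mk g)) ≠ 0) →
          W.entireLFunction 1 ≠ 0)) :
    burungaleTian_analyticRank_eq_zero_of_selmerCorank_eq_zero_of_hasCM := by
  refine burungaleTian_analyticRank_eq_zero_of_selmerCorank_eq_zero_of_hasCM_of_L_one_ne_zero ?_
  intro W _ hCM p _ hfin
  obtain ⟨S, _, _, _, _, X, _, _, _, H, _, P, _, G, sp, res, hG, hZ, hX, hMC, hctl, hsp, hloc,
    hERL⟩ := hdata W hCM p
  exact BurungaleTian2026.entireLFunction_one_ne_zero_of_skeleton W p hG hZ hX hMC hctl sp hsp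
    res hloc hERL hfin

end Literature.NumberTheory.EllipticCurves

end
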